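import Summits.ABC.IUTFork.Joshi.TemperedFrobenioidsJoshi

/-!
# Non-vacuity witnesses, part 2: the §10 interface structures of `Joshi/TemperedFrobenioidsJoshi.lean`
# (ATS III, arXiv 2401.13508v4 §10.7–§10.10 — `TemperedDivisorSystem`, `TemperedCoverings`, `Fragment3Dictionary`)

Proof-only companion (abc-iut cell, branch E, seat abc-iut-E-t34, slot T-34a; E-plan-2 RULING 08:35Z (4): "authors
first for NV witnesses of their own interface structures"; rung LADDER-ABC:A2.E). TAKES NO SIDE on [IUTchIII] Cor.
3.12 or on any author; typed ≠ proved. PURPOSE: every `structure` of the typing file is INHABITED, and each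
claim-`Prop` typed over them (Rmk. 10.9.2.4 `CoveringsDefinedOverFinite`; Thm. 10.10.1 `Thm10101` /
`StripsDeterminedByFrobTemp`) is a genuine CONDITION — satisfiable on one inhabitant and refutable on another — not a
tautology or a contradiction of the typing. All inhabitants are labelled TOY data; nothing here models Joshi's actual
curves / coverings / holomorphoids. [claim: Joshi2024ATS3, status: disputed]
-/

noncomputable section

namespace Summit.ABC.IUTFork.Joshi.ATS3

/-! ## 1. `TemperedDivisorSystem` — a TOY inhabitant (one covering, Galois group `ℤ^×` acting on divisors `ℤ`) -/

/-- `TemperedDivisorSystem` is inhabited (TOY: index set `Unit`, `Gal = ℤ^×` acting on `Div = ℤ` by multiplication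
(Mathlib's unit action), everything effective, nothing principal, `Π^temp = ℤ^×` with the identity projection; NOT a
model of print's `Z/E`). [folklore] -/
theorem nonempty_temperedDivisorSystem : Nonempty TemperedDivisorSystem.{0} :=
  ⟨{ I := Unit, Gal := (fun _ => ℤˣ), PiTemp := ℤˣ, proj := (fun _ => MonoidHom.id _), Div := (fun _ => ℤ),
     eff := (fun _ => ⊤), prin := (fun _ => ⊥), smul_eff := (fun _ _ _ _ => trivial),
     smul_prin := (fun _ g d hd => by rw [(AddSubgroup.mem_bot).1 hd, smul_zero]; exact (⊥ : AddSubgroup ℤ).zero_mem),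
     res := (fun _ _ _ => AddMonoidHom.id ℤ) }⟩

/-! ## 2. `TemperedCoverings` — inhabited; `CoveringsDefinedOverFinite` (Rmk. 10.9.2.4) is a genuine condition -/

/-- `TemperedCoverings` is inhabited and Joshi's Rmk. 10.9.2.4 condition `CoveringsDefinedOverFinite` is SATISFIABLE
(TOY: one covering, one field of definition, `DefinedOver := True`). [folklore] -/
theorem exists_coveringsDefinedOverFinite :
    ∃ T : TemperedCoverings.{0}, T.CoveringsDefinedOverFinite := by
  obtain ⟨S⟩ := nonempty_temperedDivisorSystem
  exact ⟨{ Cov := Unit, Hom := (fun _ _ => Unit), Fld := Unit, DefinedOver := (fun _ _ => True),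
            divisors := (fun _ => S) }, fun _ => ⟨(), trivial⟩⟩

/-- … and REFUTABLE (TOY: no field of definition at all, `Fld := Empty`) — so the claim-`Prop` has content.
[folklore] -/
theorem exists_not_coveringsDefinedOverFinite :
    ∃ T : TemperedCoverings.{0}, ¬ T.CoveringsDefinedOverFinite := by
  obtain ⟨S⟩ := nonempty_temperedDivisorSystem
  refine ⟨{ Cov := Unit, Hom := (fun _ _ => Unit), Fld := Empty, DefinedOver := (fun _ _ => True),
             divisors := (fun _ => S) }, fun h => ?_⟩
  obtain ⟨e, -⟩ := h ()
  exact e.elim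

/-! ## 3. `Fragment3Dictionary` — inhabited; Thm. 10.10.1's typed form `Thm10101` is a genuine condition -/

/-- `Fragment3Dictionary` is inhabited and the typed Thm. 10.10.1 (`StripsDeterminedByFrobTemp ∧
StripsOfHolomorphoidsIso`) is SATISFIABLE (TOY: one holomorphoid, one strip per decoration, trivial groups).
[folklore] -/
theorem exists_thm10101 : ∃ 𝔉 : Fragment3Dictionary.{0}, 𝔉.Thm10101 := by
  obtain ⟨T, -⟩ := exists_coveringsDefinedOverFinite
  refine ⟨{ Hol := Unit, frobTemp := (fun _ => T), Pi := (fun _ => PUnit), Strip := (fun _ => Unit),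
             StripIso := (fun _ _ _ => Unit), strip := (fun _ _ => ()), stripOfFrob := (fun _ _ => ()) }, ?_, ?_⟩
  · intro k y; rfl
  · intro y₁ y₂; exact ⟨⟨ContinuousMulEquiv.refl _⟩, fun _ => ⟨()⟩⟩

/-- … and the first clause `StripsDeterminedByFrobTemp` is REFUTABLE (TOY: two holomorphoids with the SAME tempered
Frobenioid datum but DIFFERENT strips — exactly what Thm. 10.10.1 excludes). [folklore] -/
theorem exists_not_stripsDeterminedByFrobTemp :
    ∃ 𝔉 : Fragment3Dictionary.{0}, ¬ 𝔉.StripsDeterminedByFrobTemp := by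
  obtain ⟨T, -⟩ := exists_coveringsDefinedOverFinite
  refine ⟨{ Hol := Bool, frobTemp := (fun _ => T), Pi := (fun _ => PUnit), Strip := (fun _ => Bool),
             StripIso := (fun _ _ _ => Unit), strip := (fun _ y => y), stripOfFrob := (fun _ _ => true) }, fun h => ?_⟩
  exact Bool.false_ne_true (h StripKind.tri false)

end Summit.ABC.IUTFork.Joshi.ATS3

end
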